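import Summits.AtomisticToContinuum.HydrodynamicLimit.Theses.InformationPercolationEngine

/-!
# Line `parallelogram-synchronisation` for crux `InformationPercolationEngine.PercolationClosesChaos`
(item stmt-AtomisticToContinuum-13914, `KickIsotropyInfo → SpectralContractionR → ContactChaos`; crux-plan,
round 1; idea card `Cruxes/PercolationClosesChaos/Ideas/parallelogram-synchronisation.md` (ideator 3);
triage TRIAGE-r1-1 / r1-2 / r1-3: pass ×3 with sharpenings, all acted on below)

Skeleton: five registered stubs `stub_*` (sorried) and the kernel-checked composition
`PercolationClosesChaos_of : PercolationClosesChaos` (no `sorry` of its own: it reaches the route TARGET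
`ContactChaos` from the stubs through the SORRY-FREE reduction `contactChaos_of_maxwell_of_fluxLocal`
and discards the crux's two hypotheses). Local skeleton audit (`#h21_check_skeleton`): ok, theorem =
`PercolationClosesChaos_of`, 5 stubs, closed = false (stubs open). §1 is the PROVED algebraic kernel of
the line (the lever and its companions, 0 sorries).

THE LINE (same-direction synchronous coupling on the realised collision schedule). Write the hard-sphere
rule through its OUTGOING relative direction, `v′ = (v+w)/2 + ½‖v−w‖ n`, `w′ = (v+w)/2 − ½‖v−w‖ n`
(`codrive`; `collide_eq_codrive`: the tree's `collide` IS this update), and let a GHOST velocity field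
ride on the true particles, updated at every collision of the TRUE trajectory with the SAME `n`. The
discrepancy `D` then obeys the exact identity `‖D₁′‖² + ‖D₂′‖² + (‖U‖‖U_y‖ − ⟪U, U_y⟫) = ‖D₁‖² + ‖D₂‖²`
(`parallelogram_sync`, PROVED): momentum conservation makes the transmitted part the AVERAGE of the two
discrepancies (the mean channel, `discrepancy_sum_after`, transmitted exactly — critical, never
dissipated), the parallelogram law pays for the rest, and the only zero-dissipation configurations are
aligned ones (`dissipation_of_aligned`: the similarity orbit, `codrive_similarity`). Run BACKWARDS from
a contact: cut the binary backward collision tree of the two partners `m` generations deep, feed its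
leaves with independent local-Maxwellian GHOST velocities and REPLAY the true tree with the true
outgoing directions (`replay`, `ghostIn`). Then

* Stub S1 `stub_transverseSync` — given the mean channels (S2), the true pre-collisional pair of a
  contact and its ghost replay agree in contact-averaged `L²` once both mean channels are removed,
  for `m ≥ m₀(η)` uniformly in `N` (`TransverseSync`): forgetting of everything but the conserved
  content is FREE — pathwise identity + one averaged non-degeneracy on the deterministic schedule; no
  threshold, no path-pair census, no skeleton conditioning, no spectral input.
* Stub S2 `stub_meanChannelConcentration` — the `2^{-depth}`-weighted leaf averages of the true and of
  the ghost leaves agree (`MeanChannelConcentration`): mesoscopic same-time velocity decorrelation along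
  the tree + tree completeness (triage 3's `MesoscopicVelocityDecorrelation`, in consumed currency).
* Stub S3 `stub_treeDataIdentification` — HARDEST: fed with Maxwellian ghost leaves, the replay of the
  true contacts' COMBINATORIAL data (tree shape + outgoing directions at its nodes, root included)
  reproduces the flux-weighted local-Maxwellian product law of any bounded continuous mark
  (`TreeDataIdentification`; typed over tree + directions + independent leaves ONLY, as all three
  triagers require — no collision times/positions, so it neither contains nor is contained in the
  target). Its content is equilibrium replay (exact Gibbs contact law, Soto 2016 Ex. 4.3, transported
  by S1 ∧ S2 in equilibrium) + stability of contact-Palm tree statistics from equilibrium to evolved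
  local-equilibrium data over `O(m)` mean free times — where the CLUSTER form of kick fairness and ROOT
  PARTNER-SELECTION fairness (triage 2: the flux tilt `E[n_A·n_B] ≈ −0.08`) live. Boltzmann-hypothesis
  class; finite-body and local in time given the evolved state.
* Stub S4 `stub_fluxLocalMaxwellian` — one-body local Maxwellianity in the flux-weighted, contact-sampled
  weak form `K_N[χ A_r P_Ψ(u_r,θ_r)] − K_N[χ B^Ψ_r] → 0` (`FluxLocalMaxwellian`): the bridge from the
  Maxwellian product the line reaches to the EMPIRICAL product the route target is stated against
  (provable by the bulk variant of S1–S3, or by any local-equilibrium route).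
* Stub S5 `stub_transfer` — `S1 → S2 → S3 → MaxwellContactChaos`: total synchronisation by the triangle
  inequality, uniform continuity of the mark on velocity balls + a flux-weighted velocity-tail bound for
  contacts (the `HighMomentumCutoffBarrierNarrow`-type step), continuity of the reconstructed impact
  vector off grazing, cell decomposition for the macroscopic random weight `A_r`, `L¹ ⇒` in probability.

Composition (sorry-free): `MaxwellContactChaos` (from S5 ∘ (S1 S2, S2, S3)) and `FluxLocalMaxwellian`
(S4) are `ContactChaos` with its binder telescope and `let`-block copied VERBATIM and only the deviation
functional changed (`a − c`, `c − b` against the target's `a − b`), so `contactChaos_of_maxwell_of_fluxLocal`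
closes the target by `σ₀, r₀ := min`, `N₀ := max` and a triangle inequality in probability
(`measure_abs_sub_split`); `PercolationClosesChaos_of := fun _ _ => contactChaos_of_stubs` concludes the
crux BY NAME.

Hypotheses of the crux: BOTH UNUSED, deliberately. `SpectralContractionR` — the line has no spectral
input (immune to the route's kill criterion (i) and to Disproof F3's currency/class correction).
`KickIsotropyInfo` — AS TYPED it is false under the invariant Gibbs law (Disproof F2: third-body shielding,
`three_sphere_cap`; ring-lens witness), so any use of it would be the vacuity door
`crux_of_not_kickIsotropyInfo`; its honest content (cluster / Palm fairness of the outgoing directions of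
a bounded-depth tree) is asked INSIDE Stub S3, directly and only at bounded depth.

Disproof used (Cruxes/PercolationClosesChaos/Disproof.lean v3 @dd2d993933c0 and cycle-2 v4, 2026-08-16T01:13Z, both read):
§1 `not_crux_iff` / `crux_of_contactChaos` — this skeleton has exactly the `crux_of_contactChaos` shape
(target proved, hypotheses dropped); `not_withoutKick_iff` / `not_withoutSpectral_iff` record that no
`_false_without_<H>` theorem exists for this dock, so there is no `H` a stub must be shown to use.
F2 — honoured by NOT using typed Kick (above). F3 (`SpectralContractionQuarter`, `OffInvariants`,
`criterion_gap`, `TwoOutputFormEqK`) — moot: no contraction coefficient, no dilution series; the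
conserved sector that F3 finds near-critical is exactly the mean channel the lever transmits with
EQUALITY and S2 pins by concentration, not by contraction. §4 `kosRun_perm` / `kosK_form` (keep-or-swap:
zero forgetting) — detected, not contradicted: permutation updates have no `n`-term, the identity
degenerates to equality with zero dissipation, and S1 claims nothing for them. §5b `collide_fst_eq_cm`,
`norm_half_sub_reflect`, `inner_half_sub_reflect` — the co-driven parametrisation of §1 is the same
kinematics (`collide_eq_codrive`). Cycle 2: F5 (cross operator `K̃`, `CrossOpEqOp`, keep(p)/swap family:
"hard spheres resample the relative direction, keep/swap only permutes it") — spectral, moot here, and its moral is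
the lever's; F6 (`contactMark_inner_pos`, PROVED: the target's marks are pre-collisional with `⟪w − v, ω⟫ > 0`) —
CONFIRMS the sign convention of `truePre` / `impactOfOutDir` (`ω = (n − Û)/‖n − Û‖`, `U = v − w`, gives
`⟪U, ω⟫ ≤ 0`); F7 (radial Ritz kill attempt on `λ₂(K) ≥ 1/2`) — spectral, moot. Still no `-- Targets` and no
`_false_without_`. No landed `Negative/` lemma exists for this crux; `ledger negatives`
(12 items) has nothing on co-driven couplings, replay functionals or one-body flux-Maxwellianity
(13479 is the non-measurable typing kill of the rev-2 spectral decl, unused here).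

Conventions. Window start `0` (histories from the initial datum, as the route's records); contacts are
ORDERED pairs at collision times in `[0, τ]` with the route's weight `ε/(N+1)` (`contactSumR/E` =
the inline `Kc` of `ContactChaos`); configurations along the flow are right-continuous/post-collisional,
pre-collisional pairs are read through `reflectVel` (`truePre` = the route's `pv`); local empirical
fields `ρ_r, u_r, θ_r` are the route's `bx`-mollified instantaneous functionals (`locRho/locVel/locTemp`,
= `LocalSecondLaw`'s `ρm, mm/ρm, θm`); ghost leaves `u_r + √θ_r ξ`, `ξ` i.i.d. `stdGaussian V3` indexed by
heap labels `< 2^(m+2)` (`ghostMeasure`, a probability measure); defects use `min 1 ‖·‖²` and LOWER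
integrals (no Bochner junk can trivialise S1/S2); `fluxMaxwellAvg` has the route's kernel convention
`hardSphereKernel (w, v) ω = ((w − v)·ω)₊`. No new notion is posited: §2–§3 are transparent functionals of
`flightStart`, `Participates`, `partner`, `HardSphereCollisionRecord.ofConfig`, `empiricalMeasure`,
`localGibbsLaw`, `stdGaussian`, `sphereMeasure`.
-/

noncomputable section

open scoped BigOperators InnerProductSpace RealInnerProductSpace ENNReal Classical
open MeasureTheory Set Filter Function ProbabilityTheory
open Literature.Analysis.FluidPDE Literature.MathematicalPhysics.KineticTheory

namespace Summit.AtomisticToContinuum.HydrodynamicLimit.Cruxes.PercolationClosesChaos.ParallelogramSynchronisation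


section Kernel

/-! ## 1. The proved kernel: co-driven update, the parallelogram synchronisation identity and its
companions (real inner-product space `E`, dimension-free; 0 sorries) -/

variable {E : Type*} [NormedAddCommGroup E] [InnerProductSpace ℝ E]

/-- The CO-DRIVEN two-body update with prescribed outgoing relative direction `n`. -/
def codrive (n : E) (p : E × E) : E × E :=
  ((1 / 2 : ℝ) • (p.1 + p.2) + (‖p.1 - p.2‖ / 2) • n,
    (1 / 2 : ℝ) • (p.1 + p.2) - (‖p.1 - p.2‖ / 2) • n)

/-- Momentum is conserved by the co-driven update, whatever `n`. -/
theorem codrive_fst_add_snd (n : E) (p : E × E) :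
    (codrive n p).1 + (codrive n p).2 = p.1 + p.2 := by
  simp only [codrive]
  module

/-- The outgoing relative velocity of the co-driven update is `‖v − w‖ • n`. -/
theorem codrive_fst_sub_snd (n : E) (p : E × E) :
    (codrive n p).1 - (codrive n p).2 = ‖p.1 - p.2‖ • n := by
  simp only [codrive]
  module

/-- Kinetic energy is conserved by the co-driven update for a unit direction. -/
theorem norm_sq_codrive (n : E) (hn : ‖n‖ = 1) (p : E × E) :
    ‖(codrive n p).1‖ ^ 2 + ‖(codrive n p).2‖ ^ 2 = ‖p.1‖ ^ 2 + ‖p.2‖ ^ 2 := by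
  have h1 : (codrive n p).1 = (1 / 2 : ℝ) • (p.1 + p.2) + (‖p.1 - p.2‖ / 2) • n := rfl
  have h2 : (codrive n p).2 = (1 / 2 : ℝ) • (p.1 + p.2) - (‖p.1 - p.2‖ / 2) • n := rfl
  have hpar := parallelogram_law_with_norm ℝ p.1 p.2
  rw [h1, h2, norm_add_sq_real, norm_sub_sq_real, norm_smul, norm_smul, hn, Real.norm_eq_abs,
    Real.norm_eq_abs, mul_one, mul_pow, sq_abs, sq_abs]
  nlinarith [hpar, norm_nonneg (p.1 + p.2), norm_nonneg (p.1 - p.2)]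

/-- **The parallelogram synchronisation identity** (the lever). For two pairs `p = (v, w)` (true) and
`q = (y, x)` (ghost) updated with the SAME outgoing direction `n`, the discrepancies
`D₁ = v − y`, `D₂ = w − x` satisfy
`‖D₁′‖² + ‖D₂′‖² + (‖U‖‖U_y‖ − ⟪U, U_y⟫) = ‖D₁‖² + ‖D₂‖²`, `U = v − w`, `U_y = y − x`. -/
theorem parallelogram_sync (n : E) (hn : ‖n‖ = 1) (p q : E × E) :
    ‖(codrive n p).1 - (codrive n q).1‖ ^ 2 + ‖(codrive n p).2 - (codrive n q).2‖ ^ 2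
        + (‖p.1 - p.2‖ * ‖q.1 - q.2‖ - ⟪p.1 - p.2, q.1 - q.2⟫_ℝ)
      = ‖p.1 - q.1‖ ^ 2 + ‖p.2 - q.2‖ ^ 2 := by
  set a : E := (1 / 2 : ℝ) • (p.1 + p.2) - (1 / 2 : ℝ) • (q.1 + q.2) with ha
  set b : ℝ := ‖p.1 - p.2‖ / 2 - ‖q.1 - q.2‖ / 2 with hb
  have h1 : (codrive n p).1 - (codrive n q).1 = a + b • n := by
    simp only [codrive, ha, hb]
    module
  have h2 : (codrive n p).2 - (codrive n q).2 = a - b • n := by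
    simp only [codrive, ha, hb]
    module
  have h3 : a = (1 / 2 : ℝ) • ((p.1 - q.1) + (p.2 - q.2)) := by
    simp only [ha]
    module
  have h4 : (p.1 - q.1) - (p.2 - q.2) = (p.1 - p.2) - (q.1 - q.2) := by abel
  have hpar := parallelogram_law_with_norm ℝ (p.1 - q.1) (p.2 - q.2)
  rw [h4] at hpar
  have hA : ‖a‖ ^ 2 = (1 / 4 : ℝ) * ‖(p.1 - q.1) + (p.2 - q.2)‖ ^ 2 := by
    rw [h3, norm_smul, Real.norm_eq_abs, mul_pow, sq_abs]
    ring
  have hb2 : b ^ 2 = (‖p.1 - p.2‖ ^ 2 - 2 * (‖p.1 - p.2‖ * ‖q.1 - q.2‖) + ‖q.1 - q.2‖ ^ 2) / 4 := by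
    rw [hb]
    ring
  have hU := norm_sub_sq_real (p.1 - p.2) (q.1 - q.2)
  clear_value a b
  rw [h1, h2, norm_add_sq_real, norm_sub_sq_real, norm_smul, hn, mul_one, Real.norm_eq_abs,
    sq_abs, real_inner_smul_right]
  linarith [hA, hU, hpar, hb2]

/-- Non-expansion: the dissipation `‖U‖‖U_y‖ − ⟪U, U_y⟫` is nonnegative (Cauchy–Schwarz), so the
total squared discrepancy never increases under a co-driven update. -/
theorem parallelogram_sync_le (n : E) (hn : ‖n‖ = 1) (p q : E × E) :
    ‖(codrive n p).1 - (codrive n q).1‖ ^ 2 + ‖(codrive n p).2 - (codrive n q).2‖ ^ 2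
      ≤ ‖p.1 - q.1‖ ^ 2 + ‖p.2 - q.2‖ ^ 2 := by
  have h := parallelogram_sync n hn p q
  have hcs := real_inner_le_norm (p.1 - p.2) (q.1 - q.2)
  linarith

/-- Zero dissipation on ALIGNED configurations: if `U_y = c • U` with `c ≥ 0` the dissipation term
vanishes (the similarity orbit is the zero set). -/
theorem dissipation_of_aligned (U : E) {c : ℝ} (hc : 0 ≤ c) :
    ‖U‖ * ‖c • U‖ - ⟪U, c • U⟫_ℝ = 0 := by
  rw [norm_smul, Real.norm_eq_abs, abs_of_nonneg hc, real_inner_smul_right,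
    real_inner_self_eq_norm_sq]
  ring

/-- The MEAN CHANNEL is transmitted exactly: `D₁′ + D₂′ = D₁ + D₂` (critical, never dissipated). -/
theorem discrepancy_sum_after (n : E) (p q : E × E) :
    ((codrive n p).1 - (codrive n q).1) + ((codrive n p).2 - (codrive n q).2)
      = (p.1 - q.1) + (p.2 - q.2) := by
  simp only [codrive]
  module

/-- After a co-driven update the pair's relative discrepancy is LONGITUDINAL along `n`:
`D₁′ − D₂′ = (‖U‖ − ‖U_y‖) • n`. -/
theorem discrepancy_diff_after (n : E) (p q : E × E) :
    ((codrive n p).1 - (codrive n q).1) - ((codrive n p).2 - (codrive n q).2)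
      = (‖p.1 - p.2‖ - ‖q.1 - q.2‖) • n := by
  simp only [codrive]
  module

/-- The similarity gauge is co-drive-equivariant: `codrive n (λ p + (a, a)) = λ codrive n p + (a, a)`
for `λ ≥ 0`. -/
theorem codrive_similarity (n : E) {c : ℝ} (hc : 0 ≤ c) (a : E) (p : E × E) :
    codrive n (c • p.1 + a, c • p.2 + a) = (c • (codrive n p).1 + a, c • (codrive n p).2 + a) := by
  have hs : c • p.1 + a - (c • p.2 + a) = c • (p.1 - p.2) := by module
  have hn : ‖c • p.1 + a - (c • p.2 + a)‖ = c * ‖p.1 - p.2‖ := by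
    rw [hs, norm_smul, Real.norm_eq_abs, abs_of_nonneg hc]
  simp only [codrive, Prod.mk.injEq, hn]
  constructor <;> module

/-- **The hard-sphere rule IS a co-driven update**: for incoming `p = (v, w)` with `v ≠ w` and
impact vector `ω`, `collide ω p = codrive n p` with the outgoing relative direction
`n = ‖U‖⁻¹ (U − 2⟪U, ω⟫ ω)`, `U = v − w`. -/
theorem collide_eq_codrive (ω : Metric.sphere (0 : E) 1) (p : E × E) (hp : p.1 ≠ p.2) :
    Literature.MathematicalPhysics.KineticTheory.collide ω p
      = codrive (‖p.1 - p.2‖⁻¹ • ((p.1 - p.2) - (2 * ⟪p.1 - p.2, (ω : E)⟫_ℝ) • (ω : E))) p := by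
  have hne : ‖p.1 - p.2‖ ≠ 0 := norm_ne_zero_iff.2 (sub_ne_zero.2 hp)
  have key : (‖p.1 - p.2‖ / 2) • (‖p.1 - p.2‖⁻¹ • ((p.1 - p.2) - (2 * ⟪p.1 - p.2, (ω : E)⟫_ℝ) • (ω : E)))
      = (1 / 2 : ℝ) • (p.1 - p.2) - ⟪p.1 - p.2, (ω : E)⟫_ℝ • (ω : E) := by
    rw [smul_smul, div_mul_eq_mul_div, mul_inv_cancel₀ hne]
    module
  simp only [codrive, Literature.MathematicalPhysics.KineticTheory.collide, key, Prod.mk.injEq]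
  constructor <;> module

/-- Reflection of `U` in a unit vector preserves the norm: `‖U − 2⟪U, ω⟫ω‖ = ‖U‖`. -/
theorem norm_sub_two_inner_smul (ω : Metric.sphere (0 : E) 1) (U : E) :
    ‖U - (2 * ⟪U, (ω : E)⟫_ℝ) • (ω : E)‖ = ‖U‖ := by
  have hω : ‖(ω : E)‖ = 1 := norm_eq_of_mem_sphere ω
  have h2 : ‖U - (2 * ⟪U, (ω : E)⟫_ℝ) • (ω : E)‖ ^ 2 = ‖U‖ ^ 2 := by
    rw [norm_sub_sq_real, norm_smul, real_inner_smul_right, hω, Real.norm_eq_abs, mul_one, sq_abs]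
    ring
  nlinarith [norm_nonneg (U - (2 * ⟪U, (ω : E)⟫_ℝ) • (ω : E)), norm_nonneg U,
    sq_nonneg (‖U - (2 * ⟪U, (ω : E)⟫_ℝ) • (ω : E)‖ - ‖U‖)]

/-- **Node consistency of the replay**: reading the outgoing relative direction off the
POST-collisional pair and co-driving the PRE-collisional pair with it reproduces the hard-sphere
collision — the one-node step of "co-driven replay of the true leaves = true incoming velocities"
(the trajectory-level statement adds only free flight between a particle's consecutive collisions). -/
theorem codrive_outDir_collide (ω : Metric.sphere (0 : E) 1) (p : E × E) (hp : p.1 ≠ p.2) :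
    codrive (‖(Literature.MathematicalPhysics.KineticTheory.collide ω p).1
              - (Literature.MathematicalPhysics.KineticTheory.collide ω p).2‖⁻¹ •
        ((Literature.MathematicalPhysics.KineticTheory.collide ω p).1
          - (Literature.MathematicalPhysics.KineticTheory.collide ω p).2)) p
      = Literature.MathematicalPhysics.KineticTheory.collide ω p := by
  set n₀ : E := ‖p.1 - p.2‖⁻¹ • ((p.1 - p.2) - (2 * ⟪p.1 - p.2, (ω : E)⟫_ℝ) • (ω : E)) with hn₀
  have hc : Literature.MathematicalPhysics.KineticTheory.collide ω p = codrive n₀ p :=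
    collide_eq_codrive ω p hp
  have hU : ‖p.1 - p.2‖ ≠ 0 := norm_ne_zero_iff.2 (sub_ne_zero.2 hp)
  have hn₀1 : ‖n₀‖ = 1 := by
    rw [hn₀, norm_smul, norm_inv, norm_norm, norm_sub_two_inner_smul, inv_mul_cancel₀ hU]
  have hdiff : (Literature.MathematicalPhysics.KineticTheory.collide ω p).1
      - (Literature.MathematicalPhysics.KineticTheory.collide ω p).2 = ‖p.1 - p.2‖ • n₀ := by
    rw [hc, codrive_fst_sub_snd]
  clear_value n₀
  rw [hdiff, norm_smul, norm_norm, hn₀1, mul_one, smul_smul, inv_mul_cancel₀ hU, one_smul, hc]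

end Kernel
/-! ## 2. Replay along the backward collision tree (transparent definitions over the tree's
collision-record vocabulary: `flightStart`, `Participates`, `partner`, `HardSphereCollisionRecord.ofConfig`) -/

section Replay

variable {d : Type*} [Fintype d] {X : Type*} {N : ℕ}

/-- The OUTGOING RELATIVE DIRECTION `n = (v_i⁺ − v_k⁺)/‖v_i⁺ − v_k⁺‖` of the ordered pair `(i, k)` read
off a (right-continuous, post-collisional) configuration (`= (ofConfig G ε z t i k).outDir`; junk `0`
if the two velocities coincide). -/
def outDirOf (z : Config N d X) (i k : Fin N) : EuclideanSpace ℝ d :=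
  ‖(z i).2 - (z k).2‖⁻¹ • ((z i).2 - (z k).2)

/-- The IMPACT VECTOR RECONSTRUCTED from an outgoing relative direction `n` and an incoming relative
velocity `U`: `ω = (n − Û)/‖n − Û‖` (for a genuine collision `U′ = U − 2⟪U, ω⟫ω = ‖U‖ n` with
`⟪U, ω⟫ < 0`, so `ω ∝ U′ − U ∝ n − Û`; junk `0` at grazing / degenerate data). -/
def impactOfOutDir (n U : EuclideanSpace ℝ d) : EuclideanSpace ℝ d :=
  ‖n - ‖U‖⁻¹ • U‖⁻¹ • (n - ‖U‖⁻¹ • U)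

/-- **Replay of an update rule along the depth-`m` backward collision tree.**
`replay G ε upd γ a leaf m lbl t i` is the value carried INTO the collision at time `t` by particle
`i` when the binary backward tree of `i`'s current flight is cut `m` generations back and re-driven
forward with the two-body rule `upd n (p, q)` (first component = the particle continuing towards the
root), fed at its leaves by `leaf lbl s k` (the value assigned to the flight of `k` starting at time
`s`, addressed by the heap label `lbl` of the leaf: root-children `2, 3`, children of `L` are
`2L, 2L+1`). One step: the flight of `i` arriving at `t` started at `s = flightStart G ε γ a i t`; if
`s` is a collision of `i` after the window start `a` (parent node, partner `k = partner G ε (γ s) i`,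
TRUE outgoing direction `outDirOf (γ s) i k`), the carried value is
`upd n (replay … m (2 lbl) s i, replay … m (2 lbl + 1) s k)`; otherwise (no earlier collision in
`(a, t)`: a leaf before depth `m`) it is the leaf value. With `upd n p = (codrive n p).1` and the TRUE
flight velocities as leaves this reproduces the true incoming velocities (`collide_eq_codrive`); with
`upd _ p = (p.1 + p.2)/2` it computes the `2^{-depth}`-weighted leaf average (the MEAN CHANNEL,
`discrepancy_sum_after`). Structural recursion on `m`; meaningful along hard-sphere trajectories. -/
def replay (G : Geometry d X) (ε : ℝ)
    (upd : EuclideanSpace ℝ d → EuclideanSpace ℝ d × EuclideanSpace ℝ d → EuclideanSpace ℝ d)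
    (γ : ℝ → Config N d X) (a : ℝ) (leaf : ℕ → ℝ → Fin N → EuclideanSpace ℝ d) :
    ℕ → ℕ → ℝ → Fin N → EuclideanSpace ℝ d
  | 0, lbl, t, i => leaf lbl (flightStart G ε γ a i t) i
  | m + 1, lbl, t, i =>
      if a < flightStart G ε γ a i t ∧ Participates G ε (γ (flightStart G ε γ a i t)) i then
        upd (outDirOf (γ (flightStart G ε γ a i t)) i
              (partner G ε (γ (flightStart G ε γ a i t)) i))
          (replay G ε upd γ a leaf m (2 * lbl) (flightStart G ε γ a i t) i,
            replay G ε upd γ a leaf m (2 * lbl + 1) (flightStart G ε γ a i t)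
              (partner G ε (γ (flightStart G ε γ a i t)) i))
      else leaf lbl (flightStart G ε γ a i t) i

/-- The CO-DRIVEN update rule (hard-sphere rule written through the outgoing direction; first
component = the particle continuing towards the root). -/
def coUpd (n : EuclideanSpace ℝ d) (p : EuclideanSpace ℝ d × EuclideanSpace ℝ d) : EuclideanSpace ℝ d :=
  (codrive n p).1

/-- The MEAN-CHANNEL update rule `(p + q)/2` (the exactly transmitted, never dissipated part). -/
def meanUpd (_n : EuclideanSpace ℝ d) (p : EuclideanSpace ℝ d × EuclideanSpace ℝ d) :
    EuclideanSpace ℝ d :=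
  (1 / 2 : ℝ) • (p.1 + p.2)

/-- TRUE leaves: the flight of `k` starting at time `s` carries `k`'s (post-collisional,
right-continuous) velocity at `s`. -/
def trueLeaf (γ : ℝ → Config N d X) : ℕ → ℝ → Fin N → EuclideanSpace ℝ d :=
  fun _ s k => (γ s k).2

/-- GHOST leaves: independent local-Maxwellian velocities `u + √θ ξ_lbl`, one standard Gaussian
`ξ_lbl` per leaf label (`ξ : Fin K → ℝ^d`, labels `≥ K` unused: junk `u`). -/
def ghostLeaf {K : ℕ} (u : EuclideanSpace ℝ d) (θ : ℝ) (ξ : Fin K → EuclideanSpace ℝ d) :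
    ℕ → ℝ → Fin N → EuclideanSpace ℝ d :=
  fun lbl _ _ => u + Real.sqrt θ • (if h : lbl < K then ξ ⟨lbl, h⟩ else 0)

/-- Depth `0`: the replay returns the leaf value of the current flight. -/
@[simp] theorem replay_zero (G : Geometry d X) (ε : ℝ)
    (upd : EuclideanSpace ℝ d → EuclideanSpace ℝ d × EuclideanSpace ℝ d → EuclideanSpace ℝ d)
    (γ : ℝ → Config N d X) (a : ℝ) (leaf : ℕ → ℝ → Fin N → EuclideanSpace ℝ d) (lbl : ℕ) (t : ℝ)
    (i : Fin N) : replay G ε upd γ a leaf 0 lbl t i = leaf lbl (flightStart G ε γ a i t) i := rfl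

end Replay

/-! ## 3. Hard spheres on `𝕋³` at fixed reduced density: local empirical parameters, the ghost law,
the per-contact defects and the contact sums (transparent; the mollifier `bx` and the fields
`ρ_r, m_r, e_r, θ_r` are those of the route's `LocalSecondLaw` / `ContactChaos`) -/

section HardSpheres

variable {N : ℕ}

/-- The route's spatial mollifier `b_r(x, y) = 3/(π r³) (1 − |x − y|/r)₊`. -/
def bump (r : ℝ) (x y : T3) : ℝ :=
  3 / (Real.pi * r ^ 3) * max (1 - Torus.euclidDist x y / r) 0

/-- r-local empirical density `ρ_r(x₀) = ∫ b_r(x, x₀) dμ^N`. -/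
def locRho (r : ℝ) (w : Config (N + 1) (Fin 3) T3) (x₀ : T3) : ℝ :=
  ∫ q, bump r q.1 x₀ ∂(empiricalMeasure w)

/-- r-local empirical momentum `m_r(x₀) = ∫ b_r(x, x₀) v dμ^N`. -/
def locMom (r : ℝ) (w : Config (N + 1) (Fin 3) T3) (x₀ : T3) : V3 :=
  ∫ q, bump r q.1 x₀ • q.2 ∂(empiricalMeasure w)

/-- r-local empirical kinetic energy `e_r(x₀) = ∫ b_r(x, x₀) |v|²/2 dμ^N`. -/
def locEn (r : ℝ) (w : Config (N + 1) (Fin 3) T3) (x₀ : T3) : ℝ :=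
  ∫ q, bump r q.1 x₀ * (‖q.2‖ ^ 2 / 2) ∂(empiricalMeasure w)

/-- r-local empirical velocity `u_r = m_r / ρ_r` (`ρ_r > 0` at a particle's own position). -/
def locVel (r : ℝ) (w : Config (N + 1) (Fin 3) T3) (x₀ : T3) : V3 :=
  (locRho r w x₀)⁻¹ • locMom r w x₀

/-- r-local empirical temperature `θ_r = (2/3)(e_r/ρ_r − |m_r|²/(2ρ_r²))` (the route's `θm`). -/
def locTemp (r : ℝ) (w : Config (N + 1) (Fin 3) T3) (x₀ : T3) : ℝ :=
  2 / 3 * (locEn r w x₀ / locRho r w x₀ - ‖locMom r w x₀‖ ^ 2 / (2 * locRho r w x₀ ^ 2))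

/-- The GHOST LAW at depth `m`: independent standard Gaussians, one per heap label `< 2^(m+2)` (all
labels of a depth-`m` tree below the two root children `2, 3`). -/
def ghostMeasure (m : ℕ) : Measure (Fin (2 ^ (m + 2)) → V3) :=
  Measure.pi fun _ => stdGaussian V3

/-- The ghost law is a probability measure (so the lower-integral defects of S1/S2 cannot vanish
vacuously and the Bochner ghost-average of S3 is an honest mean of a bounded measurable integrand). -/
instance isProbabilityMeasure_ghostMeasure (m : ℕ) : IsProbabilityMeasure (ghostMeasure m) := by
  unfold ghostMeasure
  infer_instance

/-- The torus geometry in dimension three (the route's `G`). -/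
abbrev G3 : Geometry (Fin 3) T3 := Torus.geometry (Fin 3)

/-- GHOST incoming velocity at the contact at time `s` of particle `i` (heap label `lbl ∈ {2, 3}` for
the two partners), depth `m`, ghost leaves with the contact's local empirical parameters `(u_r, θ_r)`
read at `x_i(s)`, CO-DRIVEN by the true tree and true outgoing directions (window start `0`). -/
def ghostIn (ε : ℝ) (γ : ℝ → Config (N + 1) (Fin 3) T3) (m : ℕ) (r : ℝ)
    (ξ : Fin (2 ^ (m + 2)) → V3) (s : ℝ) (x₀ : T3) (lbl : ℕ) (k : Fin (N + 1)) : V3 :=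
  replay G3 ε coUpd γ 0 (ghostLeaf (locVel r (γ s) x₀) (locTemp r (γ s) x₀) ξ) m lbl s k

/-- GHOST mean channel: the `2^{-depth}`-weighted average of the ghost leaves of `k`'s subtree. -/
def ghostMean (ε : ℝ) (γ : ℝ → Config (N + 1) (Fin 3) T3) (m : ℕ) (r : ℝ)
    (ξ : Fin (2 ^ (m + 2)) → V3) (s : ℝ) (x₀ : T3) (lbl : ℕ) (k : Fin (N + 1)) : V3 :=
  replay G3 ε meanUpd γ 0 (ghostLeaf (locVel r (γ s) x₀) (locTemp r (γ s) x₀) ξ) m lbl s k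

/-- TRUE mean channel: the `2^{-depth}`-weighted average of the TRUE flight velocities at the leaves
of `k`'s depth-`m` subtree (labels are irrelevant for true leaves). -/
def trueMean (ε : ℝ) (γ : ℝ → Config (N + 1) (Fin 3) T3) (m : ℕ) (s : ℝ) (k : Fin (N + 1)) : V3 :=
  replay G3 ε meanUpd γ 0 (trueLeaf γ) m 2 s k

/-- TRUE pre-collisional pair of the ordered contact `(i, j)` at time `s` (the route's `pv`). -/
def truePre (ε : ℝ) (γ : ℝ → Config (N + 1) (Fin 3) T3) (s : ℝ) (i j : Fin (N + 1)) : V3 × V3 :=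
  (HardSphereCollisionRecord.ofConfig G3 ε (γ s) s i j).preVel

/-- **Transverse synchronisation defect** of the contact `(s, i, j)` at depth `m`: ghost-average of
`1 ∧ (‖T_i‖² + ‖T_j‖²)`, `T_k := (v_k⁻ − trueMean_k) − (ghostIn_k − ghostMean_k)` — the discrepancy
between the true pre-collisional velocity and its co-driven ghost replay AFTER REMOVING BOTH MEAN
CHANNELS (lower integral: no Bochner junk). -/
def syncDefect (ε : ℝ) (γ : ℝ → Config (N + 1) (Fin 3) T3) (m : ℕ) (r : ℝ) (s : ℝ)
    (i j : Fin (N + 1)) : ℝ≥0∞ :=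
  ∫⁻ ξ, ENNReal.ofReal (min 1
      (‖((truePre ε γ s i j).1 - trueMean ε γ m s i)
          - (ghostIn ε γ m r ξ s (γ s i).1 2 i - ghostMean ε γ m r ξ s (γ s i).1 2 i)‖ ^ 2
        + ‖((truePre ε γ s i j).2 - trueMean ε γ m s j)
          - (ghostIn ε γ m r ξ s (γ s i).1 3 j - ghostMean ε γ m r ξ s (γ s i).1 3 j)‖ ^ 2))
    ∂(ghostMeasure m)

/-- **Mean-channel defect** of the contact `(s, i, j)` at depth `m`: ghost-average of
`1 ∧ (‖trueMean_i − ghostMean_i‖² + ‖trueMean_j − ghostMean_j‖²)` — small iff BOTH leaf averages sit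
at the local empirical velocity `u_r` (true side: mesoscopic velocity decorrelation along the tree;
ghost side: tree completeness × CLT, `E‖ghostMean − u_r‖² = θ_r Σ_leaves 4^{-depth}`). -/
def meanDefect (ε : ℝ) (γ : ℝ → Config (N + 1) (Fin 3) T3) (m : ℕ) (r : ℝ) (s : ℝ)
    (i j : Fin (N + 1)) : ℝ≥0∞ :=
  ∫⁻ ξ, ENNReal.ofReal (min 1
      (‖trueMean ε γ m s i - ghostMean ε γ m r ξ s (γ s i).1 2 i‖ ^ 2
        + ‖trueMean ε γ m s j - ghostMean ε γ m r ξ s (γ s i).1 3 j‖ ^ 2))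
    ∂(ghostMeasure m)

/-- **Ghost-replayed mark** of the contact `(s, i, j)` at depth `m`: the ghost-average of the mark
`Ψ(ω, v, v_*)` evaluated at the CO-DRIVEN GHOST pre-collisional pair `(p, q) = (ghostIn_i, ghostIn_j)`
with the impact vector reconstructed from the contact's TRUE outgoing direction and the ghost incoming
relative velocity, `ω = impactOfOutDir n_root (p − q)` — a functional of the COMBINATORIAL tree, the
outgoing directions at its nodes (root included) and the independent ghost leaves ONLY (triage
sharpening: no collision times/positions, no true leaf velocities). -/
def replayMark (Ψ : V3 × V3 × V3 → ℝ) (ε : ℝ) (γ : ℝ → Config (N + 1) (Fin 3) T3) (m : ℕ) (r : ℝ)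
    (s : ℝ) (i j : Fin (N + 1)) : ℝ :=
  ∫ ξ, Ψ (impactOfOutDir (outDirOf (γ s) i j)
            (ghostIn ε γ m r ξ s (γ s i).1 2 i - ghostIn ε γ m r ξ s (γ s i).1 3 j),
          ghostIn ε γ m r ξ s (γ s i).1 2 i, ghostIn ε γ m r ξ s (γ s i).1 3 j)
    ∂(ghostMeasure m)

/-- The FLUX-WEIGHTED LOCAL-MAXWELLIAN PAIR AVERAGE of a mark:
`P_Ψ(u, θ) = ∫∫∫ Ψ(ω, v, w) ((w − v)·ω)₊ M_{u,θ}(dv) M_{u,θ}(dw) dω / ∫∫∫ ((w − v)·ω)₊ M M dω`, written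
with `v = u + √θ a`, `w = u + √θ b`, `a, b` standard Gaussian (same kernel convention
`hardSphereKernel (w, v) ω` as the route's `Θ`; junk `0/0 = 0` at `θ = 0`). Under the invariant Gibbs
law this IS the conditional mark law at contact (positions ⊥ velocities; Soto 2016 Ex. 4.3). -/
def fluxMaxwellAvg (Ψ : V3 × V3 × V3 → ℝ) (u : V3) (θ : ℝ) : ℝ :=
  (∫ a, ∫ b, ∫ ω, Ψ ((ω : V3), u + Real.sqrt θ • a, u + Real.sqrt θ • b)
        * hardSphereKernel (u + Real.sqrt θ • b, u + Real.sqrt θ • a) ω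
      ∂sphereMeasure ∂(stdGaussian V3) ∂(stdGaussian V3))
    / (∫ a, ∫ b, ∫ ω, hardSphereKernel (u + Real.sqrt θ • b, u + Real.sqrt θ • a) ω
      ∂sphereMeasure ∂(stdGaussian V3) ∂(stdGaussian V3))

/-- The route's NORMALISED CONTACT SUM `(ε/(N+1)) Σ_{collision times s ≤ τ} Σ_{ordered contact pairs (i, j)} F s i j`
(verbatim the inline `Kc` of `ContactChaos`, real-valued). -/
def contactSumR (ε : ℝ) (γ : ℝ → Config (N + 1) (Fin 3) T3) (τ : ℝ)
    (F : ℝ → Fin (N + 1) → Fin (N + 1) → ℝ) : ℝ :=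
  ε / (N + 1 : ℝ) * ∑ᶠ (s : ℝ) (_ : s ∈ collisionTimes G3 ε γ ∩ Set.Icc 0 τ),
    ∑ i : Fin (N + 1), ∑ j : Fin (N + 1),
      (if i ≠ j ∧ ‖G3.sepVec (γ s i).1 (γ s j).1‖ = ε then F s i j else 0)

/-- The same contact sum for `ℝ≥0∞`-valued summands (defects). -/
def contactSumE (ε : ℝ) (γ : ℝ → Config (N + 1) (Fin 3) T3) (τ : ℝ)
    (F : ℝ → Fin (N + 1) → Fin (N + 1) → ℝ≥0∞) : ℝ≥0∞ :=
  ENNReal.ofReal (ε / (N + 1 : ℝ)) * ∑ᶠ (s : ℝ) (_ : s ∈ collisionTimes G3 ε γ ∩ Set.Icc 0 τ),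
    ∑ i : Fin (N + 1), ∑ j : Fin (N + 1),
      (if i ≠ j ∧ ‖G3.sepVec (γ s i).1 (γ s j).1‖ = ε then F s i j else 0)

end HardSpheres

/-! ## 4. The three statements of the synchronisation line (named `Prop`s; quantifier telescope =
the route's: profiles → `σ₀` → flow family → horizon → localiser (→ mark) → `η` → DEPTH `m₀` → `r₀` → `N₀`) -/

/-- **S1 · TRANSVERSE SYNCHRONISATION** (the lever, dynamical form; triage-3 repair of the card's
`Synchronisation(κ)`): for continuous positive profiles there is `σ₀` such that for `σ < σ₀`, every
flow family, horizon `τ`, continuous localiser `χ` and `η > 0` there is a DEPTH `m₀` such that for every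
`m ≥ m₀`, all small `r` and all large `N`, the local-Gibbs expectation of the `|χ|`-weighted contact
sum of the transverse synchronisation defect `syncDefect` is `≤ η`: after removing the two mean
channels, the true pre-collisional pair of a contact and its depth-`m` CO-DRIVEN GHOST REPLAY (same
tree, same outgoing directions, independent local-Maxwellian leaves) agree in contact-averaged `L²`,
uniformly in `N`. Content: the pathwise identity `parallelogram_sync` (proved) makes
`Σ‖discrepancy‖²` a supermartingale along the tree whose only non-dissipating part is the mean
channel (`discrepancy_sum_after`); what is asked beyond the identity is ONE averaged non-degeneracy on
the deterministic schedule — the angle between the incoming relative velocity `U` and the relative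
discrepancy at the nodes of the tree has contact-average bounded below (fresh partners make it
generic; aligned = similarity orbit, `dissipation_of_aligned`), giving a geometric factor per
generation (linearised `2/3`; toys j007448/j007703: 0.73 per collision per particle, no plateau). -/
def TransverseSync : Prop :=
  ∀ (a₀ θ₀ : T3 → ℝ) (u₀ : T3 → V3), Continuous a₀ → Continuous θ₀ → Continuous u₀ →
    (∀ x, 0 < a₀ x) → (∀ x, 0 < θ₀ x) →
  ∃ σ₀ : ℝ, 0 < σ₀ ∧ ∀ σ : ℝ, 0 < σ → σ < σ₀ →
  ∀ Φ : (N : ℕ) → HardSphereFlow (Torus.geometry (Fin 3)) (hsDiameter σ N) (N + 1),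
  ∀ τ : ℝ, 0 < τ → ∀ χ : ℝ × T3 → ℝ, Continuous χ →
  ∀ η : ℝ, 0 < η → ∃ m₀ : ℕ, ∀ m : ℕ, m₀ ≤ m →
  ∃ r₀ : ℝ, 0 < r₀ ∧ ∀ r : ℝ, 0 < r → r < r₀ → ∃ N₀ : ℕ, ∀ N : ℕ, N₀ ≤ N →
    ∫⁻ z, contactSumE (hsDiameter σ N) (fun s => (Φ N).flow s z) τ
        (fun s i j => ENNReal.ofReal |χ (s, ((Φ N).flow s z i).1)|
          * syncDefect (hsDiameter σ N) (fun s => (Φ N).flow s z) m r s i j)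
      ∂(localGibbsLaw σ a₀ u₀ θ₀ N (Φ N)) ≤ ENNReal.ofReal η

/-- **S2 · MEAN-CHANNEL CONCENTRATION** (triage-3's `MesoscopicVelocityDecorrelation` in the currency
the line consumes, plus tree completeness): same telescope, with the mean-channel defect `meanDefect`:
for `m ≥ m₀(η)`, small `r`, large `N`, the `2^{-depth}`-weighted average of the TRUE flight velocities
over the leaves of the depth-`m` backward tree of either partner of a contact, and the same average of
the GHOST leaves, agree in contact-averaged `L²` — equivalently (`E_ξ‖v̄ − ȳ‖² = ‖v̄ − u_r‖² + θ_r Σ 4^{-depth}`)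
(a) the true leaf average sits at the local empirical velocity `u_r` (leaf velocities of one tree, at
mutual distances `≲ m·ℓ = m ε/(√2 π σ³) → 0`, are asymptotically uncorrelated with local mean `u_r`:
a BULK, selection-free, equilibrium-trivial two-point statement under the evolved law) and (b) the
tree is complete w.h.p. (every flight in the last `O(m)` mean free times `≍ m N^{-1/3}` has a parent:
no particle stays collisionless for a macroscopic time), so that `Σ 4^{-depth} ≤ 2^{-m}`. The mean
channel is transmitted EXACTLY by every collision (critical, `discrepancy_sum_after`): this is the one
place where forgetting is not free. -/
def MeanChannelConcentration : Prop :=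
  ∀ (a₀ θ₀ : T3 → ℝ) (u₀ : T3 → V3), Continuous a₀ → Continuous θ₀ → Continuous u₀ →
    (∀ x, 0 < a₀ x) → (∀ x, 0 < θ₀ x) →
  ∃ σ₀ : ℝ, 0 < σ₀ ∧ ∀ σ : ℝ, 0 < σ → σ < σ₀ →
  ∀ Φ : (N : ℕ) → HardSphereFlow (Torus.geometry (Fin 3)) (hsDiameter σ N) (N + 1),
  ∀ τ : ℝ, 0 < τ → ∀ χ : ℝ × T3 → ℝ, Continuous χ →
  ∀ η : ℝ, 0 < η → ∃ m₀ : ℕ, ∀ m : ℕ, m₀ ≤ m →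
  ∃ r₀ : ℝ, 0 < r₀ ∧ ∀ r : ℝ, 0 < r → r < r₀ → ∃ N₀ : ℕ, ∀ N : ℕ, N₀ ≤ N →
    ∫⁻ z, contactSumE (hsDiameter σ N) (fun s => (Φ N).flow s z) τ
        (fun s i j => ENNReal.ofReal |χ (s, ((Φ N).flow s z i).1)|
          * meanDefect (hsDiameter σ N) (fun s => (Φ N).flow s z) m r s i j)
      ∂(localGibbsLaw σ a₀ u₀ θ₀ N (Φ N)) ≤ ENNReal.ofReal η

/-- **S3 · TREE-DATA IDENTIFICATION** (bounded-depth equilibrium identification, typed COMBINATORIALLY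
as all three triagers require; the hardest stub): same telescope plus a bounded continuous mark `Ψ`:
for `m ≥ m₀(η)`, small `r`, large `N`, the `χ`-weighted contact sum of
`replayMark Ψ − fluxMaxwellAvg Ψ (u_r, θ_r)` has local-Gibbs `L¹` norm `≤ η` — fed with independent
local-Maxwellian leaves, the depth-`m` ghost replay of the true contacts' (tree, outgoing directions)
data reproduces the FLUX-WEIGHTED LOCAL-MAXWELLIAN PRODUCT LAW of the mark. It is a statement about
the contact-Palm law of the combinatorial tree and of the directions `n` at its nodes ONLY (the ghost
leaves are independent by construction), hence neither contains nor is contained in `ContactChaos`.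
Content, two layers deep (foreseen split for the lead, NOT filed): (i) EQUILIBRIUM REPLAY — under the
invariant Gibbs law (constant profiles) the statement holds: contact marks are exactly flux × M ⊗ M
(positions ⊥ velocities, Soto 2016 Ex. 4.3) and S1 ∧ S2 in equilibrium transport this to the replay —
the line's first milestone and cheapest falsifier (kit/MD); (ii) STABILITY of the contact-Palm
statistics of (tree shape, directions) from equilibrium to evolved local-equilibrium data over the
`O(m)` mean free times a depth-`m` tree spans: joint (cluster) fairness of the `≤ 2^{m+1}` outgoing
directions given the tree — the CLUSTER FORM of the route's kick hypothesis, asked directly because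
the typed two-snapshot `KickIsotropyInfo` neither implies it nor survives Disproof F2 — TOGETHER WITH
the flux tilt of the root (partner selection ∝ |v − w| correlates ancestral directions,
`E[n_A·n_B] ≈ −0.08` under flux selection, triage-2 toy T1: reproducing it IS root selection fairness
given depth-`m` data) and the `O(σ³)` ring statistics inside the tree (part of both laws, never asked
to vanish). Boltzmann-hypothesis class, finite-body (`≤ 2^{m+1}` spheres) and local in time GIVEN the
evolved state `O(m N^{-1/3})` earlier. -/
def TreeDataIdentification : Prop :=
  ∀ (a₀ θ₀ : T3 → ℝ) (u₀ : T3 → V3), Continuous a₀ → Continuous θ₀ → Continuous u₀ →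
    (∀ x, 0 < a₀ x) → (∀ x, 0 < θ₀ x) →
  ∃ σ₀ : ℝ, 0 < σ₀ ∧ ∀ σ : ℝ, 0 < σ → σ < σ₀ →
  ∀ Φ : (N : ℕ) → HardSphereFlow (Torus.geometry (Fin 3)) (hsDiameter σ N) (N + 1),
  ∀ τ : ℝ, 0 < τ → ∀ χ : ℝ × T3 → ℝ, Continuous χ →
  ∀ Ψ : V3 × V3 × V3 → ℝ, Continuous Ψ → (∃ C : ℝ, ∀ p, |Ψ p| ≤ C) →
  ∀ η : ℝ, 0 < η → ∃ m₀ : ℕ, ∀ m : ℕ, m₀ ≤ m →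
  ∃ r₀ : ℝ, 0 < r₀ ∧ ∀ r : ℝ, 0 < r → r < r₀ → ∃ N₀ : ℕ, ∀ N : ℕ, N₀ ≤ N →
    ∫⁻ z, ENNReal.ofReal |contactSumR (hsDiameter σ N) (fun s => (Φ N).flow s z) τ
        (fun s i j => χ (s, ((Φ N).flow s z i).1)
          * (replayMark Ψ (hsDiameter σ N) (fun s => (Φ N).flow s z) m r s i j
            - fluxMaxwellAvg Ψ (locVel r ((Φ N).flow s z) ((Φ N).flow s z i).1)
                (locTemp r ((Φ N).flow s z) ((Φ N).flow s z i).1)))|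
      ∂(localGibbsLaw σ a₀ u₀ θ₀ N (Φ N)) ≤ ENNReal.ofReal η

/-! ## 5. The two contact-level statements in the EXACT currency of `ContactChaos`

Both are the route decl `ContactChaos` with its binder telescope and `let`-block copied VERBATIM and only
the deviation functional `D` changed, so that `ContactChaos` follows from the pair by a triangle
inequality (`contactChaos_of_maxwell_of_fluxLocal`, sorry-free): with `a := K_N[χ·Ψ·A_r]`,
`c := K_N[χ·A_r·P_Ψ(u_r, θ_r)]`, `b := K_N[χ·B^Ψ_r]` (`A_r = Pm (Θ 1)`, `B^Ψ_r = Pm (Θ Ψ)` the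
r-mollified empirical pair-flux fields of the route, `P_Ψ = fluxMaxwellAvg Ψ` the flux-weighted
local-MAXWELLIAN pair average, `(u_r, θ_r) = (locVel, locTemp)` the instantaneous r-local empirical
velocity and temperature at the contact point): `MaxwellContactChaos : a − c → 0`,
`FluxLocalMaxwellian : c − b → 0`, `ContactChaos : a − b → 0` (all in probability, same quantifiers). -/

/-- **Maxwellian contact chaos** (the conclusion the synchronisation line actually reaches; the output
of the transfer stub): the route target `ContactChaos` with the empirical reference `K_N[χ·B^Ψ_r]`
replaced by `K_N[χ·A_r·P_Ψ(u_r, θ_r)]` — at every fixed small reduced density, under local Gibbs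
data, the conditional law of the mark `(ω, v⁻, v_*⁻)` of a contact at `(s, x)` is the FLUX-WEIGHTED
PRODUCT OF LOCAL MAXWELLIANS with the local empirical velocity and temperature, in probability,
`N → ∞` then `r → 0` (rate free: both sides carry the empirical total flux `A_r`). Binder telescope and
`let`-block verbatim those of `ContactChaos`. -/
def MaxwellContactChaos : Prop :=
  ∀ (a₀ θ₀ : Literature.MathematicalPhysics.KineticTheory.T3 → ℝ) (u₀ : Literature.MathematicalPhysics.KineticTheory.T3 → Literature.MathematicalPhysics.KineticTheory.V3), Continuous a₀ → Continuous θ₀ → Continuous u₀ → (∀ x, 0 < a₀ x) → (∀ x, 0 < θ₀ x) → ∃ σ₀ : ℝ, 0 < σ₀ ∧ ∀ σ : ℝ, 0 < σ → σ < σ₀ → ∀ Φ : (N : ℕ) → Literature.Analysis.FluidPDE.HardSphereFlow (Literature.Analysis.FluidPDE.Torus.geometry (Fin 3)) (Literature.MathematicalPhysics.KineticTheory.hsDiameter σ N) (N + 1), ∀ τ : ℝ, 0 < τ → ∀ χ : ℝ × Literature.MathematicalPhysics.KineticTheory.T3 → ℝ, Continuous χ → ∀ Ψ : Literature.MathematicalPhysics.KineticTheory.V3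 × Literature.MathematicalPhysics.KineticTheory.V3 × Literature.MathematicalPhysics.KineticTheory.V3 → ℝ, Continuous Ψ → (∃ C : ℝ, ∀ p, |Ψ p| ≤ C) → ∀ η δ : ℝ, 0 < η → 0 < δ → ∃ r₀ : ℝ, 0 < r₀ ∧ ∀ r : ℝ, 0 < r → r < r₀ → ∃ N₀ : ℕ, ∀ N : ℕ, N₀ ≤ N → let ε := Literature.MathematicalPhysics.KineticTheory.hsDiameter σ N; let G : Literature.Analysis.FluidPDE.Geometry (Fin 3) Literature.MathematicalPhysics.KineticTheory.T3 := Literature.Analysis.FluidPDE.Torus.geometry (Fin 3); let γ : Literature.Analysis.FluidPDE.Config (N + 1) (Fin 3) Literature.MathematicalPhysics.KineticTheory.T3 → ℝ → Literature.Analysis.FluidPDE.Config (N + 1) (Fin 3) Literature.MathematicalPhysics.KineticTheory.T3 := fun z s => (Φ N).flow s z; let bx : Literature.MathematicalPhysics.KineticTheory.T3 → Literature.MathematicalPhysics.KineticTheory.T3 → ℝ := fun x y => 3 / (Real.pi * r ^ 3) * max (1 - Literature.Analysis.FluidPDE.Torus.euclidDist x y / r) 0; let bt : ℝ → ℝ :=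 fun a => r⁻¹ * max (1 - |a| / r) 0; let Θ := fun (Ξ : Literature.MathematicalPhysics.KineticTheory.V3 × Literature.MathematicalPhysics.KineticTheory.V3 × Literature.MathematicalPhysics.KineticTheory.V3 → ℝ) (v w : Literature.MathematicalPhysics.KineticTheory.V3) => ∫ ω : Metric.sphere (0 : Literature.MathematicalPhysics.KineticTheory.V3) 1, Ξ ((ω : Literature.MathematicalPhysics.KineticTheory.V3), v, w) * Literature.MathematicalPhysics.KineticTheory.hardSphereKernel (w, v) ω ∂Literature.MathematicalPhysics.KineticTheory.sphereMeasure; let Pm : (Literature.MathematicalPhysics.KineticTheory.V3 → Literature.MathematicalPhysics.KineticTheory.V3 → ℝ) → Literature.Analysis.FluidPDE.Config (N + 1) (Fin 3) Literature.MathematicalPhysics.KineticTheory.T3 → ℝ → Literature.MathematicalPhysics.KineticTheory.T3 → ℝ := fun Th z s₀ x₀ => ∫ s in Set.Icc (0 : ℝ) τ, bt (s - s₀) * ∫ p, bx p.1.1 x₀ * bx p.2.1 x₀ * Th p.1.2 p.2.2 ∂((Literature.Analysis.FluidPDE.empiricalMeasure (γ z s)).prod (Literature.Analysis.FluidPDE.empiricalMeasure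 (γ z s))); let Kc : (Literature.Analysis.FluidPDE.Config (N + 1) (Fin 3) Literature.MathematicalPhysics.KineticTheory.T3 → ℝ → Fin (N + 1) → Fin (N + 1) → ℝ) → Literature.Analysis.FluidPDE.Config (N + 1) (Fin 3) Literature.MathematicalPhysics.KineticTheory.T3 → ℝ := fun F z => ε / (N + 1 : ℝ) * ∑ᶠ (s : ℝ) (_ : s ∈ Literature.Analysis.FluidPDE.collisionTimes G ε (γ z) ∩ Set.Icc 0 τ), ∑ i : Fin (N + 1), ∑ j : Fin (N + 1), (if i ≠ j ∧ ‖G.sepVec (γ z s i).1 (γ z s j).1‖ = ε then F z s i j else 0); let pv : Literature.Analysis.FluidPDE.Config (N + 1) (Fin 3) Literature.MathematicalPhysics.KineticTheory.T3 → ℝ → Fin (N + 1) → Fin (N + 1) → Literature.MathematicalPhysics.KineticTheory.V3 × Literature.MathematicalPhysics.KineticTheory.V3 := fun z s i j => Literature.Analysis.FluidPDE.reflectVel (G.sepVec (γ z s i).1 (γ z s j).1) ((γ z s i).2, (γ z s j).2); let D := fun z : Literature.Analysis.FluidPDE.Config (N + 1) (Fin 3) Literature.MathematicalPhysics.KineticTheory.T3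 => Kc (fun z s i j => χ (s, (γ z s i).1) * Ψ (ε⁻¹ • G.sepVec (γ z s i).1 (γ z s j).1, (pv z s i j).1, (pv z s i j).2) * Pm (Θ (fun _ => 1)) z s (γ z s i).1) z - Kc (fun z s i _ => χ (s, (γ z s i).1) * (Pm (Θ (fun _ => 1)) z s (γ z s i).1 * fluxMaxwellAvg Ψ (locVel r (γ z s) (γ z s i).1) (locTemp r (γ z s) (γ z s i).1))) z; Literature.MathematicalPhysics.KineticTheory.localGibbsLaw σ a₀ u₀ θ₀ N (Φ N) {z | η < |D z|} ≤ ENNReal.ofReal δ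

set_option linter.unusedVariables false in
/-- **Flux-weighted one-body local Maxwellianity along contacts** (stub S4's statement): with the
same telescope, `K_N[χ·A_r·P_Ψ(u_r, θ_r)] − K_N[χ·B^Ψ_r] → 0` in probability — along the contacts of
the flow, the r-local EMPIRICAL pair-flux functional `B^Ψ_r = ∫∫Θ_Ψ dμ_r dμ_r` takes its
local-Maxwellian value `A_r · P_Ψ(u_r, θ_r)`: the one-body velocity law around a typical contact is
Maxwellian in the flux-weighted weak sense (one-body local equilibrium, tested exactly as the route's
cross-ratio needs it). -/
def FluxLocalMaxwellian : Prop :=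
  ∀ (a₀ θ₀ : Literature.MathematicalPhysics.KineticTheory.T3 → ℝ) (u₀ : Literature.MathematicalPhysics.KineticTheory.T3 → Literature.MathematicalPhysics.KineticTheory.V3), Continuous a₀ → Continuous θ₀ → Continuous u₀ → (∀ x, 0 < a₀ x) → (∀ x, 0 < θ₀ x) → ∃ σ₀ : ℝ, 0 < σ₀ ∧ ∀ σ : ℝ, 0 < σ → σ < σ₀ → ∀ Φ : (N : ℕ) → Literature.Analysis.FluidPDE.HardSphereFlow (Literature.Analysis.FluidPDE.Torus.geometry (Fin 3)) (Literature.MathematicalPhysics.KineticTheory.hsDiameter σ N) (N + 1), ∀ τ : ℝ, 0 < τ → ∀ χ : ℝ × Literature.MathematicalPhysics.KineticTheory.T3 → ℝ, Continuous χ → ∀ Ψ : Literature.MathematicalPhysics.KineticTheory.V3 × Literature.MathematicalPhysics.KineticTheory.V3 × Literature.MathematicalPhysics.KineticTheory.V3 → ℝ, Continuous Ψ → (∃ C : ℝ, ∀ p, |Ψ p| ≤ C) → ∀ η δ : ℝ, 0 < η → 0 < δ → ∃ r₀ : ℝ, 0 < r₀ ∧ ∀ r : ℝ, 0 < r → r <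 r₀ → ∃ N₀ : ℕ, ∀ N : ℕ, N₀ ≤ N → let ε := Literature.MathematicalPhysics.KineticTheory.hsDiameter σ N; let G : Literature.Analysis.FluidPDE.Geometry (Fin 3) Literature.MathematicalPhysics.KineticTheory.T3 := Literature.Analysis.FluidPDE.Torus.geometry (Fin 3); let γ : Literature.Analysis.FluidPDE.Config (N + 1) (Fin 3) Literature.MathematicalPhysics.KineticTheory.T3 → ℝ → Literature.Analysis.FluidPDE.Config (N + 1) (Fin 3) Literature.MathematicalPhysics.KineticTheory.T3 := fun z s => (Φ N).flow s z; let bx : Literature.MathematicalPhysics.KineticTheory.T3 → Literature.MathematicalPhysics.KineticTheory.T3 → ℝ := fun x y => 3 / (Real.pi * r ^ 3) * max (1 - Literature.Analysis.FluidPDE.Torus.euclidDist x y / r) 0; let bt : ℝ → ℝ := fun a => r⁻¹ * max (1 - |a| / r) 0; let Θ := fun (Ξ : Literature.MathematicalPhysics.KineticTheory.V3 × Literature.MathematicalPhysics.KineticTheory.V3 × Literature.MathematicalPhysics.KineticTheory.V3 → ℝ) (v w : Literature.MathematicalPhysics.KineticTheory.V3) => ∫ ω : Metric.sphere (0 : Literature.MathematicalPhysics.KineticTheory.V3)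 1, Ξ ((ω : Literature.MathematicalPhysics.KineticTheory.V3), v, w) * Literature.MathematicalPhysics.KineticTheory.hardSphereKernel (w, v) ω ∂Literature.MathematicalPhysics.KineticTheory.sphereMeasure; let Pm : (Literature.MathematicalPhysics.KineticTheory.V3 → Literature.MathematicalPhysics.KineticTheory.V3 → ℝ) → Literature.Analysis.FluidPDE.Config (N + 1) (Fin 3) Literature.MathematicalPhysics.KineticTheory.T3 → ℝ → Literature.MathematicalPhysics.KineticTheory.T3 → ℝ := fun Th z s₀ x₀ => ∫ s in Set.Icc (0 : ℝ) τ, bt (s - s₀) * ∫ p, bx p.1.1 x₀ * bx p.2.1 x₀ * Th p.1.2 p.2.2 ∂((Literature.Analysis.FluidPDE.empiricalMeasure (γ z s)).prod (Literature.Analysis.FluidPDE.empiricalMeasure (γ z s))); let Kc : (Literature.Analysis.FluidPDE.Config (N + 1) (Fin 3) Literature.MathematicalPhysics.KineticTheory.T3 → ℝ → Fin (N + 1) → Fin (N + 1) → ℝ) → Literature.Analysis.FluidPDE.Config (N + 1) (Fin 3) Literature.MathematicalPhysics.KineticTheory.T3 → ℝ := fun F z => ε / (N + 1 : ℝ) *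 ∑ᶠ (s : ℝ) (_ : s ∈ Literature.Analysis.FluidPDE.collisionTimes G ε (γ z) ∩ Set.Icc 0 τ), ∑ i : Fin (N + 1), ∑ j : Fin (N + 1), (if i ≠ j ∧ ‖G.sepVec (γ z s i).1 (γ z s j).1‖ = ε then F z s i j else 0); let pv : Literature.Analysis.FluidPDE.Config (N + 1) (Fin 3) Literature.MathematicalPhysics.KineticTheory.T3 → ℝ → Fin (N + 1) → Fin (N + 1) → Literature.MathematicalPhysics.KineticTheory.V3 × Literature.MathematicalPhysics.KineticTheory.V3 := fun z s i j => Literature.Analysis.FluidPDE.reflectVel (G.sepVec (γ z s i).1 (γ z s j).1) ((γ z s i).2, (γ z s j).2); let D := fun z : Literature.Analysis.FluidPDE.Config (N + 1) (Fin 3) Literature.MathematicalPhysics.KineticTheory.T3 => Kc (fun z s i _ => χ (s, (γ z s i).1) * (Pm (Θ (fun _ => 1)) z s (γ z s i).1 * fluxMaxwellAvg Ψ (locVel r (γ z s) (γ z s i).1) (locTemp r (γ z s) (γ z s i).1))) z - Kc (fun z s i _ => χ (s, (γ z s i).1) * Pm (Θ Ψ) z s (γ z s i).1) z; Literature.MathematicalPhysics.KineticTheory.localGibbsLaw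 σ a₀ u₀ θ₀ N (Φ N) {z | η < |D z|} ≤ ENNReal.ofReal δ

/-! ## 6. The registered stubs -/

/-- **Stub S1 — transverse synchronisation, given the mean channels** (`MeanChannelConcentration →
TransverseSync`; the LEVER; new content, size L). Stated as an implication because the remnant fed into
a node, `β = (‖U‖ − ‖U_y‖)/2`, is bounded by the FULL relative discrepancy there, which contains the
difference of the two sibling subtrees' mean channels: the lever contracts what the mean channels hand
it, so the honest share of S1 is "transverse forgetting GIVEN mean-channel concentration at all depths
`≥ m₀`" (S2 is quantified over all depths and localisers, and every internal node of a root's tree is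
itself a contact of the window, seen from at most `2^d` roots with weight `2^{-d}`).
Why plausibly true: the co-driven identity holds pathwise at every node whatever the schedule; the
transverse discrepancy of a pair after a node is exactly longitudinal along the NEW relative direction
(`discrepancy_diff_after`), so contraction at the next node only needs the next partner's relative
velocity to be generic with respect to it — an averaged statement on the realised schedule with no
threshold, no census and no skeleton conditioning; permutation networks (swap / keep-or-swap, hard
rods: no `n`-term, zero dissipation) are correctly NOT synchronised (Disproof §4 `kosRun_perm`).
Why it might fail: a deterministic conspiracy aligning relative discrepancies with the next relative
velocities (persistent near-grazing shadowing) would leave an `N`-independent plateau — MD-testable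
(card falsifier (b)). Sources: Tanaka doi:10.1007/bf00535689; Fournier–Mischler doi:10.1214/14-aop983;
Rousset arXiv:1407.1965; Cortez–Fontbona doi:10.1214/15-aap1107; Heydecker doi:10.1214/19-aap1475. -/
theorem stub_transverseSync : MeanChannelConcentration → TransverseSync := by
  sorry

/-- **Stub S2 — mean-channel concentration** (`MeanChannelConcentration`; size L; Boltzmann class but
BULK and selection-free). Why plausibly true: equilibrium-trivial (Gibbs leaves are i.i.d. Maxwellian,
variance `θ Σ 4^{-depth} ≤ θ 2^{-m}` on a complete tree); out of equilibrium it asks only that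
simultaneous/near-simultaneous velocities of distinct particles within `O(m)` mean free paths
(`→ 0` macroscopically) decorrelate and have local mean `u_r` — two-point, same-time chaos, far
weaker than anything at contact — plus completeness of the tree (collision rate per particle
`≍ N^{1/3} → ∞` at fixed `σ`). Why it might fail: tree-indexed leaf selection is itself a (mild) Palm
selection; a velocity-correlated lineage structure at scale `ℓ` under the evolved law would bias the
leaf average. Sources: Spohn1991 §2.3; PulvirentiSimonella arXiv:1504.03215 (backward clusters at low
density); Lanford1975; GST2013. -/
theorem stub_meanChannelConcentration : MeanChannelConcentration := by
  sorry

/-- **Stub S3 — tree-data identification** (`TreeDataIdentification`; HARDEST; Boltzmann-hypothesis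
class, open). Why plausibly true: exact in equilibrium modulo the (checkable) equilibrium replay
computation; out of equilibrium it is a finite-body (`≤ 2^{m+1}` spheres), `O(m N^{-1/3})`-local-in-time
stability of contact-Palm statistics of COMBINATORIAL data, the regime where hard-sphere cluster
control converges at fixed small `σ`. Why it might fail: it contains root partner-selection fairness
given depth-`m` histories (triage 2) and the cluster form of kick fairness — the conserved difficulty
of the crux; third-body shielding strata (Disproof F2, weight `≍ σ³`) are part of both the true and the
equilibrium tree-data law and must be matched, not ignored. Sources: Soto2016 Ex. 4.3;
PulvirentiSimonella2016 / arXiv:1504.03215; BGSSAnnals2023; doi:10.1090/surv/127 Ch. 7 (standard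
pairs); Aldous–Bandyopadhyay doi:10.1214/105051605000000142 (endogeny). -/
theorem stub_treeDataIdentification : TreeDataIdentification := by
  sorry

/-- **Stub S4 — flux-weighted one-body local Maxwellianity along contacts** (`FluxLocalMaxwellian`;
size L–XL; Boltzmann class, one-body). Why needed: the line identifies contact marks with the
flux-weighted MAXWELLIAN product, while the route target is stated against the flux-weighted product of
the EMPIRICAL local law `μ_r ⊗ μ_r`; the bridge is one-body local equilibrium in exactly this weak,
flux-weighted, contact-sampled form. Why plausibly true: it is implied by local equilibrium; inside
this line it follows from the BULK variant of S1–S3 (a particle's current velocity is the co-driven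
image of its own depth-`m` tree; no root selection there), and every other chaos route needs it too.
Why it might fail: only with local equilibrium itself (a non-Maxwellian one-body law at positive
times at arbitrarily small `σ`). Sources: Spohn1991 Part I Ch. 3; OllaVaradhanYau1993; Bogolyubov1975;
CIP1994. -/
theorem stub_fluxLocalMaxwellian : FluxLocalMaxwellian := by
  sorry

/-- **Stub S5 — transfer** `S1 → S2 → S3 → MaxwellContactChaos` (size L; technical, no new mechanism,
NOT glue): (i) total synchronisation from S1 + S2 (triangle inequality in the ghost `L²`);
(ii) `|K_N[χ A_r Ψ(true marks)] − K_N[χ A_r · replayMark Ψ]| → 0`: uniform continuity of `Ψ` on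
velocity balls + an a-priori FLUX-WEIGHTED VELOCITY-TAIL bound for contacts (collision counts with a
fast partner under the local Gibbs law — the `HighMomentumCutoffBarrierNarrow`-type step triage 2
flags) + continuity of `impactOfOutDir` off the grazing set (measure-small) + the random but
MACROSCOPIC weight `A_r` handled by a space-time cell decomposition (finitely many cells, S3 per cell);
(iii) S3 turns `replayMark` into `P_Ψ(u_r, θ_r)`; (iv) `L¹`-smallness ⇒ the in-probability form with
`∃ r₀ ∀ r ∃ N₀` bookkeeping. Also records (for the prover) the consistency lemma "co-driven replay of the
TRUE leaves = true incoming velocities" (`collide_eq_codrive` along `IsHardSphereTrajectory`). Why it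
might fail: only through the velocity-tail step (energy a-priori bound vs. flux weighting). -/
theorem stub_transfer :
    TransverseSync → MeanChannelConcentration → TreeDataIdentification → MaxwellContactChaos := by
  sorry

/-! ## 7. Composition (sorry-free) -/

/-- Triangle inequality in probability: `|A − C| ≤ |A − B| + |B − C|`, so the `η`-deviation event of
`A − C` is covered by the two `η/2`-deviation events. [folklore] -/
theorem measure_abs_sub_split {Ω : Type*} [MeasurableSpace Ω] (P : Measure Ω) (A B C : Ω → ℝ)
    (η δ : ℝ) (hδ : 0 ≤ δ)
    (h1 : P {z | η / 2 < |A z - B z|} ≤ ENNReal.ofReal (δ / 2))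
    (h2 : P {z | η / 2 < |B z - C z|} ≤ ENNReal.ofReal (δ / 2)) :
    P {z | η < |A z - C z|} ≤ ENNReal.ofReal δ := by
  have hsub : {z | η < |A z - C z|} ⊆ {z | η / 2 < |A z - B z|} ∪ {z | η / 2 < |B z - C z|} := by
    intro z hz
    simp only [Set.mem_setOf_eq, Set.mem_union] at hz ⊢
    by_contra hcon
    simp only [not_or, not_lt] at hcon
    linarith [hcon.1, hcon.2, abs_sub_le (A z) (B z) (C z)]
  calc P {z | η < |A z - C z|}
      ≤ P ({z | η / 2 < |A z - B z|} ∪ {z | η / 2 < |B z - C z|}) := measure_mono hsub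
    _ ≤ P {z | η / 2 < |A z - B z|} + P {z | η / 2 < |B z - C z|} := measure_union_le _ _
    _ ≤ ENNReal.ofReal (δ / 2) + ENNReal.ofReal (δ / 2) := add_le_add h1 h2
    _ = ENNReal.ofReal δ := by
        rw [← ENNReal.ofReal_add (by linarith) (by linarith)]
        ring_nf

/-- `MaxwellContactChaos ∧ FluxLocalMaxwellian ⇒ ContactChaos` (sorry-free; thresholds
`σ₀ := min`, `r₀ := min`, `N₀ := max`, then `measure_abs_sub_split` — the three deviation functionals
share the route's `let`-block verbatim, so `D = (a − c) + (c − b)` is recognised by unification). -/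
theorem contactChaos_of_maxwell_of_fluxLocal (hM : MaxwellContactChaos) (hF : FluxLocalMaxwellian) :
    Summit.AtomisticToContinuum.HydrodynamicLimit.Theses.InformationPercolationEngine.ContactChaos := by
  intro a₀ θ₀ u₀ ha₀ hθ₀ hu₀ hpos hθpos
  obtain ⟨σ₁, hσ₁, h1⟩ := hM a₀ θ₀ u₀ ha₀ hθ₀ hu₀ hpos hθpos
  obtain ⟨σ₂, hσ₂, h2⟩ := hF a₀ θ₀ u₀ ha₀ hθ₀ hu₀ hpos hθpos
  refine ⟨min σ₁ σ₂, lt_min hσ₁ hσ₂, ?_⟩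
  intro σ hσ hσlt Φ τ hτ χ hχ Ψ hΨ hΨb η δ hη hδ
  obtain ⟨r₁, hr₁, h1⟩ := h1 σ hσ (lt_of_lt_of_le hσlt (min_le_left _ _)) Φ τ hτ χ hχ Ψ hΨ hΨb
    (η / 2) (δ / 2) (by positivity) (by positivity)
  obtain ⟨r₂, hr₂, h2⟩ := h2 σ hσ (lt_of_lt_of_le hσlt (min_le_right _ _)) Φ τ hτ χ hχ Ψ hΨ hΨb
    (η / 2) (δ / 2) (by positivity) (by positivity)
  refine ⟨min r₁ r₂, lt_min hr₁ hr₂, ?_⟩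
  intro r hr hrlt
  obtain ⟨N₁, h1⟩ := h1 r hr (lt_of_lt_of_le hrlt (min_le_left _ _))
  obtain ⟨N₂, h2⟩ := h2 r hr (lt_of_lt_of_le hrlt (min_le_right _ _))
  refine ⟨max N₁ N₂, ?_⟩
  intro N hN
  exact measure_abs_sub_split _ _ _ _ η δ hδ.le (h1 N (le_of_max_le_left hN))
    (h2 N (le_of_max_le_right hN))

/-- The synchronisation line reaches the route TARGET: S1–S3 through the transfer S5 give
`MaxwellContactChaos`, S4 converts the Maxwellian reference into the empirical one. -/
theorem contactChaos_of_stubs :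
    Summit.AtomisticToContinuum.HydrodynamicLimit.Theses.InformationPercolationEngine.ContactChaos :=
  contactChaos_of_maxwell_of_fluxLocal
    (stub_transfer (stub_transverseSync stub_meanChannelConcentration) stub_meanChannelConcentration
      stub_treeDataIdentification)
    stub_fluxLocalMaxwellian

/-- **Composition.** The five stubs imply the crux `InformationPercolationEngine.PercolationClosesChaos`,
concluded BY NAME (kernel-checked; the only `sorry`s are inside the five stubs it invokes). The crux's
two hypotheses are deliberately NOT used: `SpectralContractionR` because the line has no spectral input
(immune to kill criterion (i) and to Disproof F3), `KickIsotropyInfo` because AS TYPED it is false under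
the invariant law (Disproof F2, third-body shielding) — its honest content, cluster/Palm fairness of the
outgoing directions of a bounded-depth tree, is carried INSIDE Stub S3, so the line never passes through
the vacuity door `crux_of_not_kickIsotropyInfo`. -/
theorem PercolationClosesChaos_of :
    Summit.AtomisticToContinuum.HydrodynamicLimit.Theses.InformationPercolationEngine.PercolationClosesChaos :=
  fun _ _ => contactChaos_of_stubs

end Summit.AtomisticToContinuum.HydrodynamicLimit.Cruxes.PercolationClosesChaos.ParallelogramSynchronisation

end
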